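import Literature.MathematicalPhysics.QuantumFieldTheory.BalabanImbrieJaffe1984to88.BIJ88Eq596NonVacuity
import Literature.MathematicalPhysics.QuantumFieldTheory.BalabanImbrieJaffe1984to88.BIJ88CutoffProfileWitness

/-!
# `BalabanImbrieJaffe1984to88.BIJ88Eq596InsNonVacuity` — T. Bałaban, J. Imbrie, A. Jaffe, *Effective action and cluster properties of the
abelian Higgs model*, Commun. Math. Phys. **114** (1988) 257–315 [BalabanImbrieJaffe1988], (5.9.6) p. 297 [PDF 41] with Sect. 5.9 p. 297:
*"These bounds allow us to insert the following characteristic functions: χ_{k+1,Λ₀^{(k)′}} = Π_{p∈Λ₀^{(k)′**}} χ(ce_kp(e_k), |v(p) − 1|) ×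
Π_{y∈Λ₀^{(k)′}} χ(cp(e_k)λ_k^{−1/4}, |ψ(y)|) Π_{b∈Λ₀^{(k)′*}} χ(cp(e_k), |(D_{ū_{k+1}}ψ)(b)|) and the integral is unchanged. … The bounds (5.9.4),
(5.9.5) allow us to insert the characteristic functions χ′_{Λ₇^{(k)}} … without changing anything"* and (5.2.3) p. 278 [PDF 22]: *"We let χ(1,x)
be an even, C^∞ function, equal to zero for |x| ≥ 1, and equal to one for |x| ≤ 9/10, and with |dⁿχ(1,x)/dxⁿ| ≤ cⁿn^{cn} for all n, x"* —
**A KERNEL NON-VACUITY CERTIFICATE FOR THE v1.1 HEAD THEOREM `BIJ88Eq596BySteps.eq596_bySteps_ins` OF ROW C2.Eq5.9.6** (the ONE theorem in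
which the three printed steps (2) rotation, (4) gauge-away, (5) insertions of the flip rule of record all enter by name): a closed instance,
for EVERY torus `P` of the standing range (`d ≥ 2`), every step `k` (`k + 1 ≤ m + K`) and every `a > 0`, in which ALL hypotheses of
`eq596_bySteps_ins` — the standing data, the p02 dictionary `Laws`, the p13 regularity, the (4.16)-clauses, the readings, the (5.2.8) input,
the positivity of the radii AND THE FIVE PRINTED BOUNDS (5.9.1)–(5.9.5) ON THE SUPPORT OF `ζχ·χ_k` — are DISCHARGED by the kernel for explicit
data with every binder inhabited, the (5.2.3) profile being p36's CONSTRUCTED Gevrey bump `BIJ88CutoffProfileWitness.gevreyCutoff`.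

statement-level skeleton of published theorems with citation tags; proofs where landed; nothing here is a claim about the Yang–Mills mass gap

WHY.  This seat's gen-13 certificate `BIJ88Eq596NonVacuity.eq596_bySteps_nonvacuous` (p332133; ref-5 R-g51-1, r16 v2.173) certifies
`eq596_bySteps`, whose sector (C) hypothesis `hins` is displayed, and records in its HONEST SCOPE that `eq596_bySteps_ins` is *"not exercised:
its `InsertionReading` carries r16's `CutoffProfile` … of which the tree holds no inhabitant"*.  That sentence is out of date: the tree HOLDS an
inhabitant — p36 g7's `BIJ88CutoffProfileWitness.gevreyCutoff : CutoffProfile` (p269401; the printed properties (5.2.3) PROVED, Gevrey bound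
included, row C2.Eq5.2.1-5.2.4).  This file closes the gap: the hypothesis family of `eq596_bySteps_ins`, INCLUDING the support claim of
Sect. 5.9 in the printed shapes of rows C2.Eq5.9.1-5.9.2 / 5.9.3 / 5.9.4-5.9.5, is jointly satisfiable, with the bounds holding
NON-vacuously on a genuine small-field support.

THE DATA (§1).  The (4.1) term, the (5.9.6) table, the gauge/scalar/Sect. 5.7/rotation readings, `Q(u_k)φ = φ ∘ emb` and the zero
dictionaries are gen 13's (`BIJ88Eq596NonVacuity.toyT`, `toyD`, `toyRG`, `toyRS`, `toyRZ`, `toyR`, `toyQφ`, imported, not re-declared).  NEW: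
* the **small-field weight** `ζχ := sfw`, the indicator of `{‖φ(x)‖ ≤ 1 ∀x} ∩ {‖ψ(y)‖ ≤ 1 ∀y}` (a bona fide restriction of the fields in the
  sense of Sect. 5.2 — its support is a small-field region containing `φ = ψ = 0`, `sfw_zero`; on it the bracket is the gen-13 Gaussian);
* the **insertion reading** `toyRI : InsertionReading P k Unit`: regions `Λ₀^{(k)′} := T^{(k+1)}` (ALL block-lattice sites) and `Λ₇^{(k)} := T₁^{(k)}`
  (ALL unit-lattice sites) — so `Λ₀^{(k)′*}`, `Λ₀^{(k)′**}`, `Λ₇^{(k)*}` are all bonds / plaquettes / bonds and NONE of the five bound families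
  quantifies over an empty set; profile `χ := gevreyCutoff`; constants `c = 5`, `e_k = p(e_k) = λ_k = L^kε = 1`, `λ = 2` (small-`λ_k` regime
  `(L^kε)^d < λ` of (5.9.2)); readings `v(p) := plaqVar (cfg v) p` (THE plaquette variable of `v`, r18's (3.3) `plaqVar`), `ū_{k+1} := cfg v` (a
  unit-modulus bond field), `A^{(k)}_b := arg u′_b` — so that the printed relation *"u′_b = e^{ie_kA′_b}"* (p. 280) HOLDS for the reading
  (`exp_I_rA`).

WHAT IS PROVED (§2–§4; 0 `sorry`, standard axioms, NO `Prop`-valued fact).  §2 `sfw_zero`, `small_of_sfw_mul_ne_zero` (support ⇒ small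
fields), `norm_sfw_le_one`, `measurable_sfw` (the small-field set is Borel: finite intersection of closed coordinate balls), `rho528_sfw`,
**`sf_integrable`** (hypothesis `hρi`: the weighted bracket is dominated by gen 13's integrable Gaussian bracket `toy_integrable` —
`Integrable.bdd_mul`), **`sf_isRD`** (hypothesis `h528` = (5.2.8) BY NAME for the weighted bracket: gen 10's constructed density `rdg` via
`isRDG_rdg_axial`); §3 the readings' kernel facts `norm_plaqVar_cfg` (`|v(p)| = 1`), `norm_rv_sub_one_le` (`|v(p) − 1| ≤ 2`), `norm_covD_cfg_le`
(`|(D_{ū}ψ)(b)| ≤ 2` for `‖ψ‖∞ ≤ 1`), `abs_rA_le` (`|A_b| ≤ π ≤ 4`), `exp_I_rA` (`e^{iA_b} = u′_b`), `norm_phiOrig_toy`/`norm_psiOrig_toy` (the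
original variables of `BIJ88Eq596Sectors` have the norms of the new ones for the trivial phases/shift), `toyRI_pos` (hypothesis `hpos`),
**`bounds_on_support`** (hypothesis `hbounds`: on the support of `ζχ·χ_k` read at the original variables, axial gauge, the six conjuncts —
(5.9.1) `|v(p) − 1| ≤ (9/10)ce_kp(e_k)` on all plaquettes, (5.9.2) small regime `|ψ(y)| ≤ (9/10)cp(e_k)λ_k^{−1/4}` on all sites, (5.9.2) large
regime (its premise `¬(L^kε)^d < λ` is false here), (5.9.3) `|(D_{ū_{k+1}}ψ)(b)| ≤ (9/10)cp(e_k)` on all bonds, (5.9.4) `|A^{(k)}_b| ≤ (9/10)cp(e_k)` on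
all bonds, (5.9.5) `|φ^{(k)}(x)| ≤ (9/10)cp(e_k)` on all sites — HOLD, each radius being `4.5`); §4 **`eq596_bySteps_ins_nonvacuous`**: the
conclusion of `eq596_bySteps_ins` for these data, obtained by APPLYING it with every hypothesis discharged in place (the gen-13 discharges
for the readings/(4.16)-clauses/`Laws`/regularity/frame data; §2–§3 for `h528`, `hρi`, `hpos`, `hbounds`).

HONEST SCOPE.  A satisfiability certificate, nothing more: the data are NOT the paper's objects (zero dictionaries, identity `Δ_{k,loc}`,
`Λ₅ = ∅`, `𝒫 = 0`, order-one radii instead of the printed `p(e_k)`-sized ones, `ū_{k+1}` read as `v` itself rather than the (4.4) average);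
it certifies that the ≈45 hypotheses of `eq596_bySteps_ins` are consistent, every binder inhabited (one term, `Ω = Obs = PUnit`, `n_Z = Fin 1`,
carriers `ℝ`), the (5.2.3) profile slot filled by a constructed Gevrey bump, and the Sect. 5.9 support bounds holding on a non-empty support
over non-empty regions.  No bound of the paper is proved here (rows C2.Eq5.9.1-5.9.5's theorems of record are p02's/p31's).  Imports this
seat's `BIJ88Eq596NonVacuity` and p36's `BIJ88CutoffProfileWitness` only (Literature + Mathlib).  Seat p34 gen 14 (unit `lit-balaban-p34-g14`;
TAKING line HOME/STATUS.md 2026-08-22T15:33:30Z).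
-/

open scoped RealInnerProductSpace

namespace Literature.MathematicalPhysics.QuantumFieldTheory.BalabanImbrieJaffe1984to88.BIJ88Eq596InsNonVacuity

open Literature.MathematicalPhysics.QuantumFieldTheory.Balaban1983to89
open BIJ88Sect3Statements (U1 toC toC_one norm_toC cfg covD plaqVar starB starP)
open BIJ85Sect1Model (HiggsField)
open BIJ85RT33 (twist)
open BIJ88Sect4Statements (bgGaugeU bgGaugePhi)
open BIJ88RenormTransf311 (axialMeasure axialBonds gaussWeight DeltaAx)
open BIJ88InductiveForm41 (Prev prevMeasure Term41 rhoPrime gaugeForm scalarForm)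
open BIJ85BlockAveragesTorus (qU)
open BIJ88RT52Restrictions (Fields fieldsMeasure IsRD)
open BIJ88Eq596Display (uCut IsDT isRD_iff_isRDG)
open BIJ88Eq596Exists (rdg isRDG_rdg_axial)
open BIJ88RT552Transl (bondMul)
open BIJ88Eq596Frame (Entry Bracket596 bracket596)
open BIJ88Eq596Density (rho596 renamedBracket)
open BIJ88Eq596Sectors (uOrig phiOrig psiOrig rho528 gaussQuad fill41)
open BIJ88Eq596SlotsByName (GaugeReading ScalarReading ExpansionReading ZReading gLHS rfk sMid2)
open BIJ88Eq596BySteps (RotationReading ukRot phiRot psiRot sMid1 fillSteps eq596_bySteps_ins norm_exp_I_mul_real)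
open BIJ88Eq596Insertions (InsertionReading chiIns)
open BIJ88Eq596NonVacuity (gOps sOps gOps_laws sOps_laws oneFam toyT toyD toyRG toyRS toyRZ toyR toyQφ toyw toy_scalarForm toy_gaugeForm
  toy_integrable)
open BIJ88CutoffProfileWitness (gevreyCutoff)
open BIJ88PertQ5715 (Zloc)
open scoped BigOperators
open _root_.MeasureTheory Complex

noncomputable section

variable (P : Params) (k : ℕ)

/-! ## §1 The data: the small-field weight and the insertion reading -/

/-- **The small-field weight** `ζχ := 𝟙{‖φ(x)‖ ≤ 1 ∀x, ‖ψ(y)‖ ≤ 1 ∀y}` — a restriction of the fields in the sense of Sect. 5.2 (*"Restrictions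
on the Fields"*, (5.2.2): characteristic functions of small `|φ(x)|`, `|ψ(y) − (Q(u_k)φ)(y)|`, …), here with sharp indicators and order-one radii.
[cite: BalabanImbrieJaffe1988, (5.2.7) p.279] -/
def sfw : Unit → Prev P k → GaugeField P k U1 → HiggsField P k → HiggsField P (k+1) → ℝ :=
  fun _ _ _ φ ψ => if (∀ x, ‖φ x‖ ≤ 1) ∧ (∀ y, ‖ψ y‖ ≤ 1) then 1 else 0

/-- **The insertion reading**: `Λ₀^{(k)′} :=` all sites of `T^{(k+1)}`, `Λ₇^{(k)} :=` all sites of `T₁^{(k)}`, `χ := gevreyCutoff` (p36's constructed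
(5.2.3) profile), `c = 5`, `e_k = p(e_k) = λ_k = L^kε = 1`, `λ = 2`; `v(p) := plaqVar (cfg v) p`, `ū_{k+1} := cfg v`, `A^{(k)}_b := arg u′_b`.
[cite: BalabanImbrieJaffe1988, (5.9.5) p.297] -/
def toyRI : InsertionReading P k Unit where
  Λ0' := fun _ => Finset.univ
  Λ7 := fun _ => Finset.univ
  χ := gevreyCutoff
  c := 5
  ek := 1
  pek := 1
  lamk := 1
  lam := 2
  s := 1
  rv := fun v p => plaqVar (cfg v) p
  rubar := fun _ _ _ v => cfg v
  rA := fun u' b => Complex.arg (cfg u' b)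

/-! ## §2 The weight: support, measurability, integrability, (5.2.8) by gen 10's construction -/

variable {P k}

/-- the support of `ζχ` contains `φ = 0`, `ψ = 0` (no premise below is empty). [cite: BalabanImbrieJaffe1988, (5.2.7) p.279] -/
theorem sfw_zero (t : Unit) (prev : Prev P k) (u : GaugeField P k U1) : sfw P k t prev u 0 0 = 1 := by
  simp [sfw]

/-- **support ⇒ small fields**: where `ζχ · r ≠ 0`, `‖φ(x)‖ ≤ 1` for all `x` and `‖ψ(y)‖ ≤ 1` for all `y`.
[cite: BalabanImbrieJaffe1988, (5.2.7) p.279] -/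
theorem small_of_sfw_mul_ne_zero {t : Unit} {prev : Prev P k} {u : GaugeField P k U1} {φ : HiggsField P k} {ψ : HiggsField P (k+1)}
    {r : ℝ} (h : sfw P k t prev u φ ψ * r ≠ 0) : (∀ x, ‖φ x‖ ≤ 1) ∧ ∀ y, ‖ψ y‖ ≤ 1 := by
  by_contra hc
  refine h ?_
  simp only [sfw]
  rw [if_neg hc, zero_mul]

/-- `‖ζχ‖ ≤ 1`. [cite: BalabanImbrieJaffe1988, (5.2.7) p.279] -/
theorem norm_sfw_le_one (t : Unit) (prev : Prev P k) (u : GaugeField P k U1) (φ : HiggsField P k) (ψ : HiggsField P (k+1)) :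
    ‖((sfw P k t prev u φ ψ : ℝ) : ℂ)‖ ≤ 1 := by
  rw [Complex.norm_real, Real.norm_eq_abs]
  simp only [sfw]
  split_ifs <;> simp

/-- kernel: the small-field set `{‖φ(x)‖ ≤ 1 ∀x}` is Borel. [cite: BalabanImbrieJaffe1988, (5.2.7) p.279] -/
private theorem measurableSet_small (j : ℕ) : MeasurableSet {φ : HiggsField P j | ∀ x, ‖φ x‖ ≤ 1} := by
  have h : {φ : HiggsField P j | ∀ x, ‖φ x‖ ≤ 1} = ⋂ x, {φ : HiggsField P j | ‖φ x‖ ≤ 1} := by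
    ext φ; simp
  rw [h]
  exact MeasurableSet.iInter fun x => measurableSet_le (measurable_pi_apply x).norm measurable_const

/-- **`ζχ` is measurable on the configurations of the term.** [cite: BalabanImbrieJaffe1988, (5.2.7) p.279] -/
theorem measurable_sfw (t : Unit) : Measurable fun q : Fields P k => ((sfw P k t q.2.1 q.1 q.2.2.1 q.2.2.2 : ℝ) : ℂ) := by
  refine Complex.measurable_ofReal.comp ?_
  simp only [sfw]
  refine Measurable.ite ?_ measurable_const measurable_const
  have hφ : Measurable fun q : Fields P k => q.2.2.1 := measurable_fst.comp (measurable_snd.comp measurable_snd)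
  have hψ : Measurable fun q : Fields P k => q.2.2.2 := measurable_snd.comp (measurable_snd.comp measurable_snd)
  exact (hφ (measurableSet_small (P := P) k)).inter (hψ (measurableSet_small (P := P) (k+1)))

/-- the weighted bracket is `ζχ` times gen 13's bracket (weight `1`). [cite: BalabanImbrieJaffe1988, (5.2.8) p.279] -/
theorem rho528_sfw (t : Unit) (prev : Prev P k) (U : GaugeField P k U1) (φ : HiggsField P k) (ψ : HiggsField P (k+1)) :
    rho528 (sfw P k) (fun _ => toyT P k) t prev U φ ψ =
      ((sfw P k t prev U φ ψ : ℝ) : ℂ) * rho528 (toyw P k) (fun _ => toyT P k) t prev U φ ψ := by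
  simp [rho528, toyw]

/-- **hypothesis `hρi` of `eq596_bySteps_ins` for the data**: the weighted bracket `ζχ · ρ′ · gaussWeight_a(φ ∘ emb, ψ)` is integrable on the
configurations of the term — dominated by gen 13's integrable Gaussian bracket (`toy_integrable`), `‖ζχ‖ ≤ 1` measurable.
[cite: BalabanImbrieJaffe1988, (5.2.8) p.279] -/
theorem sf_integrable {a : ℝ} (ha : 0 < a) (hd : 2 ≤ P.d) (t : Unit) :
    Integrable (fun q : Fields P k => rho528 (sfw P k) (fun _ => toyT P k) t q.2.1 q.1 q.2.2.1 q.2.2.2 *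
      (gaussWeight a (toyQφ P k t q.2.1 q.1 q.2.2.1) q.2.2.2 : ℂ)) (fieldsMeasure (axialMeasure P k U1)) := by
  have h := (toy_integrable (P := P) (k := k) ha hd t).bdd_mul (measurable_sfw (P := P) (k := k) t).aestronglyMeasurable
    (ae_of_all _ fun q => norm_sfw_le_one t q.2.1 q.1 q.2.2.1 q.2.2.2)
  refine h.congr (ae_of_all _ fun q => ?_)
  simp only [rho528_sfw, mul_assoc]

/-- **hypothesis `h528` of `eq596_bySteps_ins` for the data — (5.2.8) BY NAME**: gen 10's constructed density `rdg` of the weighted bracket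
satisfies the display (5.2.8) over `𝒟u δ_{Ax}` (`isRDG_rdg_axial`, standing range). [cite: BalabanImbrieJaffe1988, (5.2.8) p.279] -/
theorem sf_isRD (hk : k + 1 ≤ P.m + P.K) {a : ℝ} (ha : 0 < a) (hd : 2 ≤ P.d) :
    IsRD (axialMeasure P k U1) {()} qU (toyQφ P k) a (rho528 (sfw P k) (fun _ => toyT P k))
      (rdg (axialMeasure P k U1) {()} qU fun t prev U φ ψ =>
        rho528 (sfw P k) (fun _ => toyT P k) t prev U φ ψ * (gaussWeight a (toyQφ P k t prev U φ) ψ : ℂ)) :=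
  (isRD_iff_isRDG _ _ _ _).2 (isRDG_rdg_axial hk fun t _ => sf_integrable ha hd t)

/-! ## §3 The readings and the five printed bounds on the support -/

/-- **`|v(p)| = 1`** for the plaquette variable of a `U(1)` configuration. [cite: BalabanImbrieJaffe1988, (3.3) p.265] -/
theorem norm_plaqVar_cfg {j : ℕ} (v : GaugeField P j U1) (p : Balaban1983to89.Plaq P j) : ‖plaqVar (cfg v) p‖ = 1 := by
  simp [plaqVar, cfg, norm_toC]

/-- **(5.9.1)-shape for the reading `v(p)`**: `|v(p) − 1| ≤ 2` for every `v` and `p`. [cite: BalabanImbrieJaffe1988, (5.9.1) p.296] -/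
theorem norm_rv_sub_one_le {j : ℕ} (v : GaugeField P j U1) (p : Balaban1983to89.Plaq P j) : ‖plaqVar (cfg v) p - 1‖ ≤ 2 := by
  refine (norm_sub_le _ _).trans ?_
  rw [norm_plaqVar_cfg, norm_one]
  norm_num

/-- **(5.9.3)-shape for the reading `ū_{k+1} := cfg v`**: `|(D_{ū}ψ)(b)| ≤ 2` when `‖ψ(y)‖ ≤ 1` for all `y` (`D_ū ψ(b) = ū(b)ψ(b₊) − ψ(b₋)`, r18's
(3.3) `covD` at `ε⁻¹ = 1`). [cite: BalabanImbrieJaffe1988, (5.9.3) p.297] -/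
theorem norm_covD_cfg_le {j : ℕ} (v : GaugeField P j U1) {ψ : HiggsField P j} (hψ : ∀ y, ‖ψ y‖ ≤ 1) (b : PBond P j) :
    ‖covD 1 (cfg v) ψ b‖ ≤ 2 := by
  simp only [covD, Complex.ofReal_one, one_mul]
  refine (norm_sub_le _ _).trans ?_
  rw [norm_mul]
  have h1 : ‖cfg v b‖ = 1 := norm_toC _
  rw [h1, one_mul]
  linarith [hψ b.tgt, hψ b.src]

/-- **(5.9.4)-shape for the reading `A^{(k)}_b := arg u′_b`**: `|A_b| ≤ π ≤ 4`. [cite: BalabanImbrieJaffe1988, (5.9.4) p.297] -/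
theorem abs_rA_le (u' : GaugeField P k U1) (b : PBond P k) : |(toyRI P k).rA u' b| ≤ 4 :=
  (Complex.abs_arg_le_pi _).trans Real.pi_le_four

/-- **the reading `A^{(k)}` IS the gauge potential of `u′`**: `e^{ie_kA_b} = u′_b` (`e_k = 1`; p. 280 *"u′_b = e^{ie_kA′_b}"*).
[cite: BalabanImbrieJaffe1988, (5.3.1) p.280] -/
theorem exp_I_rA (u' : GaugeField P k U1) (b : PBond P k) :
    Complex.exp (((toyRI P k).rA u' b : ℂ) * Complex.I) = cfg u' b := by
  have h := Complex.norm_mul_exp_arg_mul_I (cfg u' b)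
  have h1 : ‖cfg u' b‖ = 1 := norm_toC _
  rw [h1, Complex.ofReal_one, one_mul] at h
  exact h

/-- the original scalar field of `BIJ88Eq596Sectors` has the norm of the new one for the trivial phase and zero shift (`φ = λ⁻¹(φ^{(k)} + c_t)`
with `λ ≡ 1`, `c_t = 0`). [cite: BalabanImbrieJaffe1988, (5.8.1) p.295] -/
theorem norm_phiOrig_toy (t : Unit) (prev : Prev P k) (u' : GaugeField P k U1) (v : GaugeField P (k+1) U1) (φ : HiggsField P k)
    (ψ : HiggsField P (k+1)) (x : Balaban1983to89.Site P k) :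
    ‖phiOrig (P := P) (k := k) (ι := Unit) (fun _ => ∅) (fun _ _ => 1) (fun _ _ _ _ _ => 1) (fun _ _ _ _ _ => 0) t prev u' v φ ψ x‖
      = ‖φ x‖ := by
  simp [phiOrig, twist, toC_one]

/-- the original block field has the norm of the renamed one for the trivial phase (`ψ_old = λ′⁻¹ψ`, `λ′ ≡ 1`).
[cite: BalabanImbrieJaffe1988, (5.4.6) p.282] -/
theorem norm_psiOrig_toy (t : Unit) (prev : Prev P k) (u' : GaugeField P k U1) (v : GaugeField P (k+1) U1) (ψ : HiggsField P (k+1))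
    (y : Balaban1983to89.Site P (k+1)) :
    ‖psiOrig (P := P) (k := k) (ι := Unit) (fun _ => ∅) (fun _ _ => 1) (fun _ _ _ _ _ => 1) t prev u' v ψ y‖ = ‖ψ y‖ := by
  simp [psiOrig, twist, toC_one]

/-- **hypothesis `hpos` of `eq596_bySteps_ins`**: the four radii `ce_kp(e_k)`, `cp(e_k)λ_k^{−1/4}`, `cp(e_k)(L^kε)⁻¹`, `cp(e_k)` are positive (all `= 5`).
[cite: BalabanImbrieJaffe1988, (5.9.2) p.297] -/
theorem toyRI_pos :
    0 < (toyRI P k).c * (toyRI P k).ek * (toyRI P k).pek ∧ 0 < (toyRI P k).c * (toyRI P k).pek * (toyRI P k).lamk ^ (-(1 / 4 : ℝ)) ∧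
      0 < (toyRI P k).c * (toyRI P k).pek * (toyRI P k).s⁻¹ ∧ 0 < (toyRI P k).c * (toyRI P k).pek := by
  simp only [toyRI, Real.one_rpow]
  norm_num

/-- **hypothesis `hbounds` of `eq596_bySteps_ins` — THE FIVE PRINTED BOUNDS HOLD ON THE SUPPORT OF `ζχ·χ_k`** (read at the original variables of
`BIJ88Eq596Sectors`, axial gauge): (5.9.1) on all plaquettes, (5.9.2) (small-`λ_k` regime; the large-regime clause has a false premise) on all
block sites, (5.9.3) on all block bonds, (5.9.4) on all unit bonds, (5.9.5) on all unit sites — each within `9/10` of a radius `5`.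
[cite: BalabanImbrieJaffe1988, (5.9.5) p.297] -/
theorem bounds_on_support (t : Unit) (prev : Prev P k) (u' : GaugeField P k U1) (v : GaugeField P (k+1) U1) (φ : HiggsField P k)
    (ψ : HiggsField P (k+1))
    (hne : sfw P k t prev (uOrig (ι := Unit) (fun _ => ∅) (fun _ _ => 1) t u' v)
        (phiOrig (ι := Unit) (fun _ => ∅) (fun _ _ => 1) (fun _ _ _ _ _ => 1) (fun _ _ _ _ _ => 0) t prev u' v φ ψ)
        (psiOrig (ι := Unit) (fun _ => ∅) (fun _ _ => 1) (fun _ _ _ _ _ => 1) t prev u' v ψ) *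
      (toyT P k).chi prev (cfg (uOrig (ι := Unit) (fun _ => ∅) (fun _ _ => 1) t u' v))
        (phiOrig (ι := Unit) (fun _ => ∅) (fun _ _ => 1) (fun _ _ _ _ _ => 1) (fun _ _ _ _ _ => 0) t prev u' v φ ψ) ≠ 0) :
    (∀ p ∈ starP ((toyRI P k).Λ0' t), ‖(toyRI P k).rv v p - 1‖ ≤ 9 / 10 * ((toyRI P k).c * (toyRI P k).ek * (toyRI P k).pek)) ∧
    ((toyRI P k).s ^ P.d < (toyRI P k).lam →
      ∀ y ∈ (toyRI P k).Λ0' t, ‖ψ y‖ ≤ 9 / 10 * ((toyRI P k).c * (toyRI P k).pek * (toyRI P k).lamk ^ (-(1 / 4 : ℝ)))) ∧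
    (¬ (toyRI P k).s ^ P.d < (toyRI P k).lam → ∀ y ∈ (toyRI P k).Λ0' t,
      |‖ψ y‖ - (8 * (toyRI P k).lam) ^ (-(1 / 2 : ℝ)) * (toyRI P k).s ^ (((P.d : ℝ) - 2) / 2)| ≤
        9 / 10 * ((toyRI P k).c * (toyRI P k).pek * (toyRI P k).s⁻¹)) ∧
    (∀ b ∈ starB ((toyRI P k).Λ0' t), ‖covD 1 ((toyRI P k).rubar t prev u' v) ψ b‖ ≤ 9 / 10 * ((toyRI P k).c * (toyRI P k).pek)) ∧
    (∀ b ∈ starB ((toyRI P k).Λ7 t), |(toyRI P k).rA u' b| ≤ 9 / 10 * ((toyRI P k).c * (toyRI P k).pek)) ∧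
    (∀ x ∈ (toyRI P k).Λ7 t, ‖φ x‖ ≤ 9 / 10 * ((toyRI P k).c * (toyRI P k).pek)) := by
  obtain ⟨hφ', hψ'⟩ := small_of_sfw_mul_ne_zero hne
  have hφ : ∀ x, ‖φ x‖ ≤ 1 := fun x => by rw [← norm_phiOrig_toy t prev u' v φ ψ x]; exact hφ' x
  have hψ : ∀ y, ‖ψ y‖ ≤ 1 := fun y => by rw [← norm_psiOrig_toy t prev u' v ψ y]; exact hψ' y
  have hA := abs_rA_le (P := P) (k := k) u'
  simp only [toyRI, Real.one_rpow, one_pow, mul_one, inv_one] at hA ⊢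
  refine ⟨fun p _ => ?_, fun _ y _ => ?_, fun h => absurd (by norm_num) h, fun b _ => ?_, fun b _ => ?_, fun x _ => ?_⟩
  · linarith [norm_rv_sub_one_le v p]
  · linarith [hψ y]
  · linarith [norm_covD_cfg_le v hψ b]
  · linarith [hA b]
  · linarith [hφ x]

/-! ## §4 The certificate -/

/-- **KERNEL NON-VACUITY CERTIFICATE FOR `eq596_bySteps_ins`.**  For every torus `P` with `d ≥ 2`, every step `k` of the standing range and every
`a > 0`, the conclusion of `BIJ88Eq596BySteps.eq596_bySteps_ins` — (5.9.6) at measure level with the printed steps (2) rotation, (4) gauge-away,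
(5) insertions all by name, the (5.9.6) entry `chars` being `ζχ·χ_k·χ_{k+1,Λ₀′}χ′_{Λ₇}` with r16's printed inserted functions of the CONSTRUCTED
(5.2.3) profile `gevreyCutoff` — holds for the data of §1, obtained by APPLYING `eq596_bySteps_ins` with all of its hypotheses discharged by the
kernel: (5.2.8) (`sf_isRD`, gen 10's construction), integrability (`sf_integrable`), the frame data, p02's `Laws`, p13's regularity, the
(4.16)-clauses and readings (as in gen 13's certificate), the positivity of the radii (`toyRI_pos`) and THE FIVE PRINTED BOUNDS (5.9.1)–(5.9.5)
ON THE SUPPORT (`bounds_on_support`).  Every binder is inhabited; the support of `ζχ` is non-empty (`sfw_zero`); the regions are all sites.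
[cite: BalabanImbrieJaffe1988, (5.9.6) p.297] -/
theorem eq596_bySteps_ins_nonvacuous (hk : k + 1 ≤ P.m + P.K) {a : ℝ} (ha : 0 < a) (hd : 2 ≤ P.d) :
    IsDT (axialMeasure P k U1) {()} (fun _ => ∅) qU
        (bracket596 (fill41
          (fillSteps (toyD P k) (toyRG P k) (toyRS P k)
            ⟨sMid1 (toyR P k) (fun _ => toyT P k) a (fun _ => ∅) (fun _ _ => 1) (fun _ _ _ _ _ => 1) (fun _ _ _ _ _ => 1) (fun _ _ _ _ _ => 0),
              fun t prev u' v φ ψ _ => sMid2 (toyRS P k) t prev u' v φ ψ, 0, 0⟩ (toyRZ P k))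
          (fun _ => toyT P k) (sfw P k) a (fun _ => ∅) (fun _ _ => 1) (fun _ _ _ _ _ => 1) (fun _ _ _ _ _ => 1) (fun _ _ _ _ _ => 0)
          (chiIns (toyRI P k))))
        (rho596 {()} (fun _ => ∅) (renamedBracket (toyQφ P k) a (rho528 (sfw P k) (fun _ => toyT P k)) (fun _ => ∅)
          (fun _ _ _ _ _ => 1) (fun _ _ _ _ _ => 1))) ∧
      ∫ v, ∫ ψ, rho596 {()} (fun _ => ∅) (renamedBracket (toyQφ P k) a (rho528 (sfw P k) (fun _ => toyT P k)) (fun _ => ∅)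
          (fun _ _ _ _ _ => 1) (fun _ _ _ _ _ => 1)) v ψ ∂volume ∂fieldMeasure P (k+1) U1 =
        ∫ v, ∫ ψ, rdg (axialMeasure P k U1) {()} qU (fun t prev U φ ψ =>
          rho528 (sfw P k) (fun _ => toyT P k) t prev U φ ψ * (gaussWeight a (toyQφ P k t prev U φ) ψ : ℂ)) v ψ
          ∂volume ∂fieldMeasure P (k+1) U1 := by
  refine eq596_bySteps_ins (toyD P k) (fun _ => toyT P k) a (toyQφ P k) (fun _ => ∅) (fun _ _ => 1) (fun _ _ _ _ _ => 1)
    (fun _ _ _ _ _ => 1) (fun _ _ _ _ _ => 0) (toyRG P k) (toyRS P k) (toyRZ P k) (sfw P k) hk (sf_isRD hk ha hd)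
    (fun t _ => sf_integrable ha hd t) (fun _ _ => measurable_const) (fun _ _ => measurable_const) (fun _ _ _ _ _ => rfl)
    (fun _ => Set.univ) (fun _ _ _ _ _ _ _ _ => Set.mem_univ _) (fun t _ u' _ w => ?_) (toyRI P k) toyRI_pos
    (fun t _ prev u' v φ ψ _ hne => bounds_on_support t prev u' v φ ψ hne)
    (fun _ _ => gOps_laws) (fun t _ prev u' v _ => ?_) (toyR P k) (fun _ _ _ _ _ _ _ _ => rfl) (fun _ _ _ _ _ _ _ _ => rfl)
    (fun t _ prev u' v φ ψ _ => ?_) (fun _ _ _ _ _ _ _ _ => rfl) (fun _ _ _ _ _ _ _ _ => rfl)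
    (fun t prev u' v φ ψ _ => sMid2 (toyRS P k) t prev u' v φ ψ) 0 0 (fun _ _ _ _ _ => sOps_laws) (fun t _ prev u' v φ ψ _ => ?_)
    1 1 (fun _ _ _ _ _ => 1) (fun _ _ _ => rfl) (fun _ _ _ _ _ _ _ => rfl) (fun _ _ _ _ _ _ _ => rfl)
    (fun _ _ _ _ _ _ _ _ => Matrix.PosDef.one) (fun _ _ _ _ _ _ _ _ => contDiffOn_const)
  · -- hQS: the shift `s ≡ 1` does not move `u′`
    have hb : ∀ b, (1 : GaugeField P k U1) b = 1 := fun _ => rfl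
    have h1 : bondMul u' (1 : GaugeField P k U1) = u' := by funext b; rw [BIJ88RT552Transl.bondMul_apply, hb, mul_one]
    have h2 : (bondMul u' fun b => ((1 : GaugeField P k U1) b)⁻¹) = u' := by
      funext b; rw [BIJ88RT552Transl.bondMul_apply, hb, inv_one, mul_one]
    exact ⟨by rw [h1], by rw [h2]⟩
  · -- hread: both sides vanish (Λ₅ = ∅; Λ₅′** = 0 on the carrier)
    rw [toy_gaugeForm, mul_zero, gLHS]
    simp [toyRG, gOps]
  · -- hΔ: the identity kernel is gauge covariant — `Σ|e^{i}φ|² = Σ|φ|²`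
    rw [toy_scalarForm, toy_scalarForm]
    refine Finset.sum_congr rfl fun x _ => ?_
    simp only [phiRot, bgGaugePhi, norm_mul, norm_exp_I_mul_real, mul_one]
  · -- hreadS: `F(0)` = the read forms, `𝒫_{k,loc}`-entry `0`
    simp [toyD]

end

end Literature.MathematicalPhysics.QuantumFieldTheory.BalabanImbrieJaffe1984to88.BIJ88Eq596InsNonVacuity
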